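import Summits.SmoothPoincare4.SmoothPoincare4.Theorems.SblfDescentRungOneDefs
import Literature.Topology.FourManifolds.TorusDiffeoLoops
import HarnessLib

/-!
# Assembly check: `helper_sliceGluing_torusAngular` from the leaves
`helper_sliceGluing_rigidCollar` (σ = ±1), `helper_sliceGluing_vanishingDegree` (F0) and
`helper_sliceGluing_discExtension` (DX) — crux `RungOne`, line `Sketch` (lead, reshape 6).
The three leaves are stated (sorried) exactly as registered; the assembly is sorry-free.
-/

noncomputable section

set_option linter.dupNamespace false

namespace Summit.SmoothPoincare4.SmoothPoincare4.Cruxes.RungOne.Sketch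

open Set Function
open scoped _root_.Manifold _root_.ContDiff _root_.Topology RealInnerProductSpace
open Literature.Topology.FourManifolds

attribute [local instance] Literature.Topology.FourManifolds.fact_finrank_euclideanSpace_succ

/-! ## Scratch: the remaining brick statements and the assembly of `torusAngular` -/

/-- notation -/
local notation "𝔼 " n:arg => EuclideanSpace ℝ (Fin n)
/-- notation -/
local notation "𝕊²" => (Metric.sphere (0 : EuclideanSpace ℝ (Fin 3)) (1 : ℝ))

open Literature.AlgebraicTopology.SingularHomology

/-- F0 -/
theorem helper_sliceGluing_vanishingDegree : ∀ (X : Type) [TopologicalSpace X] [T2Space X] [SecondCountableTopology X] [CompactSpace X] [ChartedSpace (𝔼 4) X] [IsManifold (𝓡 4) ∞ X] [SimplyConnectedSpace X] (o : SmoothOrientation (𝓡 4) X) (f : X → 𝕊²), IsSimplifiedBrokenLefschetzFibration o f ∅ 0 → f '' ({p : X | ¬ Surjective (mfderiv (𝓡 4) (𝓡 2) f p)} \ (↑(∅ : Finset X) : Set X)) = sphereEquator 1 → ∀ (v : 𝕊²), (v : 𝔼 3) 0 = 0 → (v : 𝔼 3) 1 = 0 → (∀ y : 𝕊², ⟪(y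 : 𝔼 3), (v : 𝔼 3)⟫ < 0 → (∀ q, f q = y → Surjective (mfderiv (𝓡 4) (𝓡 2) f q)) ∧ Nonempty ((Fin (2 * 0) → ℤ) ≃ₗ[ℤ] singularHomology ℤ ℤ ↥(f ⁻¹' {y}) 1)) → (∀ y : 𝕊², ⟪(y : 𝔼 3), ((-v : 𝕊²) : 𝔼 3)⟫ < 0 → (∀ q, f q = y → Surjective (mfderiv (𝓡 4) (𝓡 2) f q)) ∧ Nonempty ((Fin (2 * (0 + 1)) → ℤ) ≃ₗ[ℤ] singularHomology ℤ ℤ ↥(f ⁻¹' {y}) 1)) → ∀ (ε : ℝ) (ν : (Metric.sphere (0 : 𝔼 2) 1) × 𝔼 3 → X), IsFoldTube f v ε ν → ∀ (Fb : Type) [TopologicalSpace Fb] [T2Space Fb] [SecondCountableTopology Fb] [CompactSpace Fb] [ConnectedSpace Fb] [ChartedSpace (𝔼 2) Fb] [IsManifold (𝓡 2) ∞ Fb] (ιT : Fb × 𝔼 2 → X), IsTorusSideProduct f v ιT → ∀ (s₁ s₂ ε₂ s₁' s₂' ε₂' : ℝ) (ιC ιC' : ((Metric.sphere (0 : 𝔼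 2) 1) × (Metric.sphere (0 : 𝔼 2) 1)) × ((Metric.sphere (0 : 𝔼 2) 1) × ℝ) → X) (aC bC aC' bC' : X → Metric.sphere (0 : 𝔼 2) 1), IsRigidCollar f v ν 1 Real.arctan s₁ s₂ ε₂ ιC aC bC → IsRigidCollar f v ν (-1) Real.arctan s₁' s₂' ε₂' ιC' aC' bC' → ε₂ ≤ ε → ε₂' ≤ ε → (∀ (θ : Fb) (R : ℝ), 0 < R → (∀ t : ℝ, s₁ < (v : 𝔼 3) 2 * ((f (ιT (θ, R • ((circlePt t : Metric.sphere (0 : 𝔼 2) 1) : 𝔼 2))) : 𝕊²) : 𝔼 3) 2 ∧ (v : 𝔼 3) 2 * ((f (ιT (θ, R • ((circlePt t : Metric.sphere (0 : 𝔼 2) 1) : 𝔼 2))) : 𝕊²) : 𝔼 3) 2 < s₂) → ∃ L : ℝ → ℝ, Continuous L ∧ (∀ t, L (t + 1) = L t) ∧ ∀ t : ℝ, aC (ιT (θ, R • ((circlePt t : Metric.sphere (0 : 𝔼 2) 1) : 𝔼 2))) = circlePt (L t)) ∨ (∀ (θ : Fb) (R : ℝ), 0 < R → (∀ t : ℝ,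 s₁' < (v : 𝔼 3) 2 * ((f (ιT (θ, R • ((circlePt t : Metric.sphere (0 : 𝔼 2) 1) : 𝔼 2))) : 𝕊²) : 𝔼 3) 2 ∧ (v : 𝔼 3) 2 * ((f (ιT (θ, R • ((circlePt t : Metric.sphere (0 : 𝔼 2) 1) : 𝔼 2))) : 𝕊²) : 𝔼 3) 2 < s₂') → ∃ L : ℝ → ℝ, Continuous L ∧ (∀ t, L (t + 1) = L t) ∧ ∀ t : ℝ, aC' (ιT (θ, R • ((circlePt t : Metric.sphere (0 : 𝔼 2) 1) : 𝔼 2))) = circlePt (L t)) := by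
  sorry

/-- DX -/
theorem helper_sliceGluing_discExtension : gramain_loopHomotopy_translationLoop_torus → ∀ (X : Type) [TopologicalSpace X] [T2Space X] [SecondCountableTopology X] [CompactSpace X] [ChartedSpace (𝔼 4) X] [IsManifold (𝓡 4) ∞ X] (o : SmoothOrientation (𝓡 4) X) (f : X → 𝕊²), IsSimplifiedBrokenLefschetzFibration o f ∅ 0 → f '' ({p : X | ¬ Surjective (mfderiv (𝓡 4) (𝓡 2) f p)} \ (↑(∅ : Finset X) : Set X)) = sphereEquator 1 → ∀ (v : 𝕊²), (v : 𝔼 3) 0 = 0 → (v : 𝔼 3) 1 = 0 → (∀ y : 𝕊², ⟪(y : 𝔼 3), (v : 𝔼 3)⟫ < 0 → (∀ q, f q = y → Surjective (mfderiv (𝓡 4) (𝓡 2) f q)) ∧ Nonempty ((Fin (2 * 0) → ℤ) ≃ₗ[ℤ] singularHomology ℤ ℤ ↥(f ⁻¹' {y}) 1)) → (∀ y : 𝕊², ⟪(y : 𝔼 3), ((-v : 𝕊²) : 𝔼 3)⟫ < 0 → (∀ q, f q = y → Surjective (mfderiv (𝓡 4) (𝓡 2) f q)) ∧ Nonempty ((Fin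 (2 * (0 + 1)) → ℤ) ≃ₗ[ℤ] singularHomology ℤ ℤ ↥(f ⁻¹' {y}) 1)) → ∀ (ε : ℝ) (ν : (Metric.sphere (0 : 𝔼 2) 1) × 𝔼 3 → X), IsFoldTube f v ε ν → ∀ (Fb : Type) [TopologicalSpace Fb] [T2Space Fb] [SecondCountableTopology Fb] [CompactSpace Fb] [ConnectedSpace Fb] [ChartedSpace (𝔼 2) Fb] [IsManifold (𝓡 2) ∞ Fb] (ιT : Fb × 𝔼 2 → X), IsTorusSideProduct f v ιT → ∀ (σ s₁ s₂ ε₂ : ℝ) (ιC : ((Metric.sphere (0 : 𝔼 2) 1) × (Metric.sphere (0 : 𝔼 2) 1)) × ((Metric.sphere (0 : 𝔼 2) 1) × ℝ) → X) (aC bC : X → Metric.sphere (0 : 𝔼 2) 1), (σ = 1 ∨ σ = -1) → IsRigidCollar f v ν σ Real.arctan s₁ s₂ ε₂ ιC aC bC → ε₂ ≤ ε → (∀ (θ : Fb) (R : ℝ), 0 < R → (∀ t : ℝ, s₁ < (v : 𝔼 3) 2 * ((f (ιT (θ, R • ((circlePt t : Metric.sphere (0 : 𝔼 2) 1) : 𝔼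 2))) : 𝕊²) : 𝔼 3) 2 ∧ (v : 𝔼 3) 2 * ((f (ιT (θ, R • ((circlePt t : Metric.sphere (0 : 𝔼 2) 1) : 𝔼 2))) : 𝕊²) : 𝔼 3) 2 < s₂) → ∃ L : ℝ → ℝ, Continuous L ∧ (∀ t, L (t + 1) = L t) ∧ ∀ t : ℝ, aC (ιT (θ, R • ((circlePt t : Metric.sphere (0 : 𝔼 2) 1) : 𝔼 2))) = circlePt (L t)) → ∃ (sA sB : ℝ) (A : X → Metric.sphere (0 : 𝔼 2) 1), IsTorusAngular f v ν σ sA sB ε₂ A ∧ (∀ (u : Metric.sphere (0 : 𝔼 2) 1) (x : 𝔼 3) (z : X), x ∈ Metric.ball (0 : 𝔼 3) ε₂ → sA < x 0 ^ 2 + x 1 ^ 2 - x 2 ^ 2 → x 0 ^ 2 + x 1 ^ 2 - x 2 ^ 2 < sB → f z = f (ν (u, x)) → A z = A (ν (u, x)) → z ∈ ν '' ({u} ×ˢ Metric.ball (0 : 𝔼 3) ε₂)) := by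
  sorry

/-- collar (registered, expanded form) -/
theorem helper_sliceGluing_rigidCollar : ∀ (X : Type) [TopologicalSpace X] [T2Space X] [SecondCountableTopology X] [CompactSpace X] [ChartedSpace (𝔼 4) X] [IsManifold (𝓡 4) ∞ X] (o : SmoothOrientation (𝓡 4) X) (f : X → 𝕊²), IsSimplifiedBrokenLefschetzFibration o f ∅ 0 → f '' ({p : X | ¬ Surjective (mfderiv (𝓡 4) (𝓡 2) f p)} \ (↑(∅ : Finset X) : Set X)) = sphereEquator 1 → ∀ (v : 𝕊²), (v : 𝔼 3) 0 = 0 → (v : 𝔼 3) 1 = 0 → (∀ y : 𝕊², ⟪(y : 𝔼 3), (v : 𝔼 3)⟫ < 0 → (∀ q, f q = y → Surjective (mfderiv (𝓡 4) (𝓡 2) f q)) ∧ Nonempty ((Fin (2 * 0) → ℤ) ≃ₗ[ℤ] singularHomology ℤ ℤ ↥(f ⁻¹' {y}) 1)) → (∀ y : 𝕊², ⟪(y : 𝔼 3), ((-v : 𝕊²) : 𝔼 3)⟫ < 0 → (∀ q, f q = y → Surjective (mfderiv (𝓡 4) (𝓡 2) f q)) ∧ Nonempty ((Fin (2 * (0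 + 1)) → ℤ) ≃ₗ[ℤ] singularHomology ℤ ℤ ↥(f ⁻¹' {y}) 1)) → ∀ (ε : ℝ) (ν : (Metric.sphere (0 : 𝔼 2) 1) × 𝔼 3 → X), 0 < ε → ε < 1 → ContMDiffOn ((𝓡 1).prod 𝓘(ℝ, 𝔼 3)) (𝓡 4) ∞ ν (Set.univ ×ˢ Metric.ball 0 ε) → Set.InjOn ν (Set.univ ×ˢ Metric.ball 0 ε) → IsOpen (ν '' (Set.univ ×ˢ Metric.ball 0 ε)) → (∀ p : (Metric.sphere (0 : 𝔼 2) 1) × 𝔼 3, p.2 ∈ Metric.ball (0 : 𝔼 3) ε → Function.Injective (mfderiv ((𝓡 1).prod 𝓘(ℝ, 𝔼 3)) (𝓡 4) ν p)) → (∀ q : X, ¬ Surjective (mfderiv (𝓡 4) (𝓡 2) f q) ↔ ∃ u, ν (u, 0) = q) → (∀ (u : Metric.sphere (0 : 𝔼 2) 1) (x : 𝔼 3), x ∈ Metric.ball (0 : 𝔼 3) ε → ((f (ν (u, x)) : 𝕊²) : 𝔼 3) 0 = √(1 - (x 0 ^ 2 + x 1 ^ 2 - x 2 ^ 2) ^ 2)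 * (u : 𝔼 2) 0 ∧ ((f (ν (u, x)) : 𝕊²) : 𝔼 3) 1 = √(1 - (x 0 ^ 2 + x 1 ^ 2 - x 2 ^ 2) ^ 2) * (u : 𝔼 2) 1 ∧ ((f (ν (u, x)) : 𝕊²) : 𝔼 3) 2 = (v : 𝔼 3) 2 * (x 0 ^ 2 + x 1 ^ 2 - x 2 ^ 2)) → ∀ (σ : ℝ) (g : ℝ → ℝ), (σ = 1 ∨ σ = -1) → ContDiff ℝ ∞ g → StrictMono g → (∀ t, 0 < deriv g t) → g 0 = 0 → (∀ t, |g t| < Real.pi / 2) → ∃ (s₁ s₂ ε₂ : ℝ) (ιC : ((Metric.sphere (0 : 𝔼 2) 1) × (Metric.sphere (0 : 𝔼 2) 1)) × ((Metric.sphere (0 : 𝔼 2) 1) × ℝ) → X) (aC bC : X → (Metric.sphere (0 : 𝔼 2) 1)), 0 < s₁ ∧ s₁ < s₂ ∧ 0 < ε₂ ∧ ε₂ ≤ ε ∧ s₂ < ε₂ ^ 2 / 4 ∧ ContMDiffOn (((𝓡 1).prod (𝓡 1)).prod ((𝓡 1).prod 𝓘(ℝ, ℝ))) (𝓡 4) ∞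 ιC (Set.univ ×ˢ (Set.univ ×ˢ Set.Ioo s₁ s₂)) ∧ (∀ (a b u : Metric.sphere (0 : 𝔼 2) 1) (s : ℝ), s₁ < s → s < s₂ → ((f (ιC ((a, b), (u, s))) : 𝕊²) : 𝔼 3) 0 = √(1 - s ^ 2) * (u : 𝔼 2) 0 ∧ ((f (ιC ((a, b), (u, s))) : 𝕊²) : 𝔼 3) 1 = √(1 - s ^ 2) * (u : 𝔼 2) 1 ∧ ((f (ιC ((a, b), (u, s))) : 𝕊²) : 𝔼 3) 2 = (v : 𝔼 3) 2 * s ∧ aC (ιC ((a, b), (u, s))) = a ∧ bC (ιC ((a, b), (u, s))) = b) ∧ ContMDiffOn (𝓡 4) (𝓡 1) ∞ aC {x | s₁ < (v : 𝔼 3) 2 * ((f x : 𝕊²) : 𝔼 3) 2 ∧ (v : 𝔼 3) 2 * ((f x : 𝕊²) : 𝔼 3) 2 < s₂} ∧ ContMDiffOn (𝓡 4) (𝓡 1) ∞ bC {x | s₁ < (v : 𝔼 3) 2 * ((f x : 𝕊²) : 𝔼 3) 2 ∧ (v : 𝔼 3) 2 * ((f x : 𝕊²) : 𝔼 3) 2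 < s₂} ∧ (∀ x : X, s₁ < (v : 𝔼 3) 2 * ((f x : 𝕊²) : 𝔼 3) 2 → (v : 𝔼 3) 2 * ((f x : 𝕊²) : 𝔼 3) 2 < s₂ → ∃ u : Metric.sphere (0 : 𝔼 2) 1, ιC ((aC x, bC x), (u, (v : 𝔼 3) 2 * ((f x : 𝕊²) : 𝔼 3) 2)) = x) ∧ (∀ (u : Metric.sphere (0 : 𝔼 2) 1) (x : 𝔼 3), x ∈ Metric.ball (0 : 𝔼 3) ε₂ → s₁ < x 0 ^ 2 + x 1 ^ 2 - x 2 ^ 2 → x 0 ^ 2 + x 1 ^ 2 - x 2 ^ 2 < s₂ → ((aC (ν (u, x)) : Metric.sphere (0 : 𝔼 2) 1) : 𝔼 2) 0 = Real.cos (g (x 2)) * (u : 𝔼 2) 0 + σ * Real.sin (g (x 2)) * (u : 𝔼 2) 1 ∧ ((aC (ν (u, x)) : Metric.sphere (0 : 𝔼 2) 1) : 𝔼 2) 1 = -Real.sin (g (x 2)) * (u : 𝔼 2) 0 + σ * Real.cos (g (x 2)) * (u : 𝔼 2) 1) := by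
  sorry

/-- Ang from collar ×2 + F0 + DX. -/
theorem helper_sliceGluing_torusAngular : gramain_loopHomotopy_translationLoop_torus → ∀ (X : Type) [TopologicalSpace X] [T2Space X] [SecondCountableTopology X] [CompactSpace X] [ChartedSpace (𝔼 4) X] [IsManifold (𝓡 4) ∞ X] [SimplyConnectedSpace X] (o : SmoothOrientation (𝓡 4) X) (f : X → 𝕊²), IsSimplifiedBrokenLefschetzFibration o f ∅ 0 → f '' ({p : X | ¬ Surjective (mfderiv (𝓡 4) (𝓡 2) f p)} \ (↑(∅ : Finset X) : Set X)) = sphereEquator 1 → ∀ (v : 𝕊²), (v : 𝔼 3) 0 = 0 → (v : 𝔼 3) 1 = 0 → (∀ y : 𝕊², ⟪(y : 𝔼 3), (v : 𝔼 3)⟫ < 0 → (∀ q, f q = y → Surjective (mfderiv (𝓡 4) (𝓡 2) f q)) ∧ Nonempty ((Fin (2 * 0) → ℤ) ≃ₗ[ℤ] singularHomology ℤ ℤ ↥(f ⁻¹' {y}) 1)) → (∀ y : 𝕊², ⟪(y : 𝔼 3), ((-v : 𝕊²) : 𝔼 3)⟫ < 0 → (∀ q, f q = y → Surjective (mfderiv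 (𝓡 4) (𝓡 2) f q)) ∧ Nonempty ((Fin (2 * (0 + 1)) → ℤ) ≃ₗ[ℤ] singularHomology ℤ ℤ ↥(f ⁻¹' {y}) 1)) → ∀ (ε : ℝ) (ν : (Metric.sphere (0 : 𝔼 2) 1) × 𝔼 3 → X), 0 < ε → ε < 1 → ContMDiffOn ((𝓡 1).prod 𝓘(ℝ, 𝔼 3)) (𝓡 4) ∞ ν (Set.univ ×ˢ Metric.ball 0 ε) → Set.InjOn ν (Set.univ ×ˢ Metric.ball 0 ε) → IsOpen (ν '' (Set.univ ×ˢ Metric.ball 0 ε)) → (∀ p : (Metric.sphere (0 : 𝔼 2) 1) × 𝔼 3, p.2 ∈ Metric.ball (0 : 𝔼 3) ε → Function.Injective (mfderiv ((𝓡 1).prod 𝓘(ℝ, 𝔼 3)) (𝓡 4) ν p)) → (∀ q : X, ¬ Surjective (mfderiv (𝓡 4) (𝓡 2) f q) ↔ ∃ u, ν (u, 0) = q) → (∀ (u : Metric.sphere (0 : 𝔼 2) 1) (x : 𝔼 3), x ∈ Metric.ball (0 : 𝔼 3) ε → ((f (ν (u, x)) : 𝕊²) : 𝔼 3) 0 =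 √(1 - (x 0 ^ 2 + x 1 ^ 2 - x 2 ^ 2) ^ 2) * (u : 𝔼 2) 0 ∧ ((f (ν (u, x)) : 𝕊²) : 𝔼 3) 1 = √(1 - (x 0 ^ 2 + x 1 ^ 2 - x 2 ^ 2) ^ 2) * (u : 𝔼 2) 1 ∧ ((f (ν (u, x)) : 𝕊²) : 𝔼 3) 2 = (v : 𝔼 3) 2 * (x 0 ^ 2 + x 1 ^ 2 - x 2 ^ 2)) → ∃ (σ sA sB ε₂ : ℝ) (A : X → (Metric.sphere (0 : 𝔼 2) 1)), (σ = 1 ∨ σ = -1) ∧ 0 < sA ∧ sA < sB ∧ 0 < ε₂ ∧ ε₂ ≤ ε ∧ sB < ε₂ ^ 2 / 4 ∧ ContMDiffOn (𝓡 4) (𝓡 1) ∞ A {x | sA < (v : 𝔼 3) 2 * ((f x : 𝕊²) : 𝔼 3) 2} ∧ (∀ x : X, sA < (v : 𝔼 3) 2 * ((f x : 𝕊²) : 𝔼 3) 2 → ∃ y : 𝔼 4, mfderiv (𝓡 4) (𝓡 2) f x y = 0 ∧ mfderiv (𝓡 4) (𝓡 1) A x y ≠ 0) ∧ (∀ (u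 : Metric.sphere (0 : 𝔼 2) 1) (x : 𝔼 3), x ∈ Metric.ball (0 : 𝔼 3) ε₂ → sA < x 0 ^ 2 + x 1 ^ 2 - x 2 ^ 2 → x 0 ^ 2 + x 1 ^ 2 - x 2 ^ 2 < sB → ((A (ν (u, x)) : Metric.sphere (0 : 𝔼 2) 1) : 𝔼 2) 0 = Real.cos (Real.arctan (x 2)) * (u : 𝔼 2) 0 + σ * Real.sin (Real.arctan (x 2)) * (u : 𝔼 2) 1 ∧ ((A (ν (u, x)) : Metric.sphere (0 : 𝔼 2) 1) : 𝔼 2) 1 = -Real.sin (Real.arctan (x 2)) * (u : 𝔼 2) 0 + σ * Real.cos (Real.arctan (x 2)) * (u : 𝔼 2) 1) ∧ (∀ (u : Metric.sphere (0 : 𝔼 2) 1) (x : 𝔼 3) (z : X), x ∈ Metric.ball (0 : 𝔼 3) ε₂ → sA < x 0 ^ 2 + x 1 ^ 2 - x 2 ^ 2 → x 0 ^ 2 + x 1 ^ 2 - x 2 ^ 2 < sB → f z = f (ν (u, x)) → A z = A (ν (u, x)) → z ∈ ν '' ({u} ×ˢ Metric.ball (0 : 𝔼 3) ε₂)) :=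 by
  intro hEE X _ _ _ _ _ _ _ o f hf hC v hv0 hv1 hlo hhi ε ν hε hε1 hνs hνi hνo hνd hνz hνf
  have hT : IsFoldTube f v ε ν := ⟨hε, hε1, hνs, hνi, hνo, hνd, hνz, hνf⟩
  have hg : ContDiff ℝ ∞ Real.arctan := Real.contDiff_arctan
  have hgm : StrictMono Real.arctan := Real.arctan_strictMono
  have hg0 : Real.arctan 0 = 0 := Real.arctan_zero
  have hgb : ∀ t, |Real.arctan t| < Real.pi / 2 := fun t =>
    abs_lt.2 ⟨Real.neg_pi_div_two_lt_arctan t, Real.arctan_lt_pi_div_two t⟩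
  have hgd : ∀ t, 0 < deriv Real.arctan t := fun t => by
    rw [Real.deriv_arctan]; positivity
  -- rigid collars for both signs
  obtain ⟨s₁, s₂, ε₂, ιC, aC, bC, h1, h2, h3, h4, h5, h6, h7, h8, h9, h10, h11⟩ :=
    helper_sliceGluing_rigidCollar X o f hf hC v hv0 hv1 hlo hhi ε ν hε hε1 hνs hνi hνo hνd hνz hνf
      1 Real.arctan (Or.inl rfl) hg hgm hgd hg0 hgb
  obtain ⟨s₁', s₂', ε₂', ιC', aC', bC', h1', h2', h3', h4', h5', h6', h7', h8', h9', h10', h11'⟩ :=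
    helper_sliceGluing_rigidCollar X o f hf hC v hv0 hv1 hlo hhi ε ν hε hε1 hνs hνi hνo hνd hνz hνf
      (-1) Real.arctan (Or.inr rfl) hg hgm hgd hg0 hgb
  have hRC : IsRigidCollar f v ν 1 Real.arctan s₁ s₂ ε₂ ιC aC bC :=
    ⟨h1, h2, h3, h5, h6, h7, h8, h9, h10, fun u x hx ha hb => ?_⟩
  swap
  · obtain ⟨e0, e1⟩ := h11 u x hx ha hb
    ext i; fin_cases i
    · simpa using e0
    · simpa using e1
  have hRC' : IsRigidCollar f v ν (-1) Real.arctan s₁' s₂' ε₂' ιC' aC' bC' :=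
    ⟨h1', h2', h3', h5', h6', h7', h8', h9', h10', fun u x hx ha hb => ?_⟩
  swap
  · obtain ⟨e0, e1⟩ := h11' u x hx ha hb
    ext i; fin_cases i
    · simpa using e0
    · simpa using e1
  -- the torus side as a product
  obtain ⟨Fb, _, _, _, _, _, _, _, ιT, hemb, hrange, hι0, hι0r, hιf⟩ :=
    hf.exists_isSmoothEmbedding_prod_range_eq_preimage_hemisphere hC (-v) (by simpa using hv0)
      (by simpa using hv1)
  have hneg : -(-v) = v := neg_neg v
  have hTS : IsTorusSideProduct f v ιT := ⟨hemb, hrange, hι0, hι0r, hιf⟩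
  -- the degree of the loop of vanishing cycles is `±1` for one of the two signs
  rcases helper_sliceGluing_vanishingDegree X o f hf hC v hv0 hv1 hlo hhi ε ν hT Fb ιT hTS s₁ s₂ ε₂
      s₁' s₂' ε₂' ιC ιC' aC bC aC' bC' hRC hRC' h4 h4' with hL | hL
  · obtain ⟨sA, sB, A, hA, hAlev⟩ := helper_sliceGluing_discExtension hEE X o f hf hC v hv0 hv1 hlo hhi ε ν
      hT Fb ιT hTS 1 s₁ s₂ ε₂ ιC aC bC (Or.inl rfl) hRC h4 hL
    refine ⟨1, sA, sB, ε₂, A, Or.inl rfl, hA.pos, hA.lt, hA.ε₂_pos, h4, hA.lt_sq, hA.contMDiffOn,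
      hA.submersive, fun u x hx ha hb => ?_, hAlev⟩
    have e := hA.rigid u x hx ha hb
    exact ⟨by simpa using congrArg (fun z : 𝔼 2 => z 0) e,
      by simpa using congrArg (fun z : 𝔼 2 => z 1) e⟩
  · obtain ⟨sA, sB, A, hA, hAlev⟩ := helper_sliceGluing_discExtension hEE X o f hf hC v hv0 hv1 hlo hhi ε ν
      hT Fb ιT hTS (-1) s₁' s₂' ε₂' ιC' aC' bC' (Or.inr rfl) hRC' h4' hL
    refine ⟨-1, sA, sB, ε₂', A, Or.inr rfl, hA.pos, hA.lt, hA.ε₂_pos, h4', hA.lt_sq, hA.contMDiffOn,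
      hA.submersive, fun u x hx ha hb => ?_, hAlev⟩
    have e := hA.rigid u x hx ha hb
    exact ⟨by simpa using congrArg (fun z : 𝔼 2 => z 0) e,
      by simpa using congrArg (fun z : 𝔼 2 => z 1) e⟩

end Summit.SmoothPoincare4.SmoothPoincare4.Cruxes.RungOne.Sketch

end
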